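import Literature.RingTheory.Valuation.FiniteAlgebraOverValuationRingOfAlgClosed
import Literature.RingTheory.Valuation.AlgHomIntoValuationSubring
import Literature.RingTheory.Idempotents.AlgHomCornerOfReduction
import Literature.RingTheory.Idempotents.FiniteAlgebraLocalFactorsRank
import Literature.RingTheory.Etale.FiniteFreeAlgebraGeometricPointCount
import Literature.AlgebraicGeometry.Resolution.GeneralizedStabilityFiniteRankLemmas
import HarnessLib

/-!
# Integral points of a finite free algebra over the valuation ring of an algebraically closed field, counted by their specialisation
# ([StacksProject] Tag 04GG, 00U3, 02M0; [Liu2002] §10.1.3 — the algebraic form of «reduction of the generic geometric fibre = special fibre with multiplicities»)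

Topic `Literature/RingTheory/Valuation`.  THEOREMS only (no def, no instance, no notation, no named fact, no `sorry`).  Cell `hodgecm-mathlib` (D-0151),
FLOOR 0, programme F0P5a, crux item stmt-HodgeConjecture-24832 — the (S-γ2) ALGEBRAIC ASSEMBLY (desk `F0/P5a/S-gamma2-DESK.v0` §1, step list (L3b);
F0P5a LEAD WORDS #11/#12, MOD-PLAN row L5.5a).

Let `V ⊆ Ω` be the valuation ring of an ALGEBRAICALLY CLOSED field, `𝔪` its maximal ideal, `κ = κ(V)` its residue field, and `B` a commutative
`V`-algebra, module-finite and FREE of rank `d` (the coordinate ring of the base change of a finite flat cover along an integral point), with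
REDUCED generic fibre `Ω ⊗_V B` («the generic fibre is étale over the point»).  By ★ p798923 (`ValuationSubring.exists_completeOrthogonalIdempotents_isLocalRing`,
over ★ p798139 + ★ p798065) `B` carries a complete orthogonal family of idempotents `e_I`, indexed by the maximal ideals `I` of the special fibre
`B ⧸ 𝔪B` (= the `κ`-points of the special fibre), separating them, with LOCAL corners `B_I := B ⧸ (1 - e_I)`.

* `card_algHom_residue_comp_eq` — **for every `κ`-point `χ : B →ₐ[V] κ` of the special fibre, the number of INTEGRAL points `ψ : B →ₐ[V] V`
  SPECIALISING to `χ` (`residue ∘ ψ = χ`) equals `finrank_V B_I`, `I` the corner of `χ` (`ker χ = I.comap mk`)** — chain: prescribed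
  specialisation = prescribed kernel (★ `IsLocalRing.residue_comp_eq_iff_ker_eq`) = «lands in corner `I`» (★ `apply_sub_one_mem_iff_ker_eq_comap`,
  p799045) = points of the corner (★ `card_algHom_map_eq_one_eq`, p799283) = `Ω`-points of the corner (★ `ValuationSubring.card_algHom_apply_eq_one_eq`)
  = its rank (★ `card_algHom_eq_finrank_of_isReduced_baseChange`, p799165; corner free and with reduced generic fibre by ★ p799283);
* `card_algHom_residue_comp_eq_length` — … = the LENGTH of the special fibre of the corner `B_I ⧸ 𝔪B_I` (★ `length_quotient_eq_finrank_of_isAlgClosed'`,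
  p799283; `κ` algebraically closed, ★ `isAlgClosed_residueField_of_isAlgClosed`), i.e. the multiplicity of the point `I` in the special fibre;
* `card_algHom_eq_finrank` / `sum_finrank_corner_eq` — the total count `#(B →ₐ[V] V) = d = Σ_I finrank_V B_I`.

With ★ p799041 + ★ p799183 (points of the generic fibre of a finite cover over `x` ↔ integral points over `x̃`; special-fibre points ↔ `κ(R)`-points,
reductions ↔ specialisations) and the affine base change of a finite morphism (rows (L2a)(L2b)), this is the multiset identity
`Σ_{y over x} {red_𝒯 y} = Σ_ȳ length_ȳ • {ȳ}`.

HC_CM is proved only modulo the 7 printed citations until rung 0 closes; this file is a generic leaf and changes no count.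

## References
* [StacksProject] The Stacks Project, Tags 04GG (finite algebras over henselian local rings), 00U3 (points of a product), 02M0 (length and rank).
* [Liu2002] Q. Liu, *Algebraic Geometry and Arithmetic Curves*, §10.1.3 (reduction of points of finite covers).
-/

set_option autoImplicit false

open IsLocalRing
open scoped TensorProduct

namespace ValuationSubring

variable {Ω : Type} [Field Ω] [IsAlgClosed Ω] (V : ValuationSubring Ω)
  {B : Type} [CommRing B] [Algebra V B] [Module.Finite V B] [Module.Free V B]

/-- In a local ring an idempotent congruent to `1` modulo `𝔪` is `1`. [cite: StacksProject, Tag 04GG] -/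
theorem eq_one_of_isIdempotentElem_of_sub_one_mem {R : Type*} [CommRing R] [IsLocalRing R] {u : R} (hu : IsIdempotentElem u)
    (h : u - 1 ∈ maximalIdeal R) : u = 1 := by
  have hunit : IsUnit u := by
    by_contra hnu
    have hu' : u ∈ maximalIdeal R := (IsLocalRing.mem_maximalIdeal _).mpr hnu
    have : (1 : R) ∈ maximalIdeal R := by simpa using (maximalIdeal R).sub_mem hu' h
    exact (maximalIdeal R).ne_top_iff_one.mp (maximalIdeal.isMaximal R).ne_top this
  obtain ⟨w, hw⟩ := hunit
  calc u = ↑w⁻¹ * (u * u) := by rw [← hw, ← mul_assoc, Units.inv_mul, one_mul]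
    _ = 1 := by rw [hu.eq, ← hw, Units.inv_mul]

/-- **Integral points with prescribed specialisation, counted**: for `χ : B →ₐ[V] κ(V)` whose kernel is the corner `I` of a separating complete
orthogonal family `e` with local corners (★ p798923), the `V`-points `ψ : B →ₐ[V] V` with `residue ∘ ψ = χ` are exactly the `V`-points with
`ψ (e I) = 1`, and their number is `finrank_V (B ⧸ (1 - e I))` (`B` free with reduced generic fibre `Ω ⊗_V B`).
[cite: StacksProject, Tag 04GG] [cite: StacksProject, Tag 00U3] [cite: Liu2002, §10.1.3] -/
theorem card_algHom_residue_comp_eq [IsReduced (Ω ⊗[↥V] B)] [Fintype (MaximalSpectrum (B ⧸ (maximalIdeal ↥V).map (algebraMap (↥V) B)))]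
    (e : MaximalSpectrum (B ⧸ (maximalIdeal ↥V).map (algebraMap (↥V) B)) → B) (he : CompleteOrthogonalIdempotents e)
    (hsep1 : ∀ I, 1 - e I ∈ I.asIdeal.comap (Ideal.Quotient.mk _)) (hsep0 : ∀ I I', I ≠ I' → e I ∈ I'.asIdeal.comap (Ideal.Quotient.mk _))
    (I : MaximalSpectrum (B ⧸ (maximalIdeal ↥V).map (algebraMap (↥V) B))) (χ : B →ₐ[↥V] ResidueField ↥V)
    (hχ : RingHom.ker (χ : B →+* ResidueField ↥V) = I.asIdeal.comap (Ideal.Quotient.mk _)) :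
    Nat.card {ψ : B →ₐ[↥V] ↥V // (residue ↥V).comp (ψ : B →+* ↥V) = (χ : B →+* ResidueField ↥V)} =
      Module.finrank (↥V) (B ⧸ Ideal.span {1 - e I}) := by
  classical
  haveI : Algebra.IsIntegral (↥V) B := Algebra.IsIntegral.of_finite (↥V) B
  -- prescribed specialisation = prescribed kernel = lands in the corner `I` = value `1` at `e I`
  have hiff : ∀ ψ : B →ₐ[↥V] ↥V,
      (residue ↥V).comp (ψ : B →+* ↥V) = (χ : B →+* ResidueField ↥V) ↔ ψ (e I) = 1 := fun ψ => by
    rw [IsLocalRing.residue_comp_eq_iff_ker_eq, hχ,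
      ← Literature.RingTheory.Idempotents.apply_sub_one_mem_iff_ker_eq_comap e hsep1 hsep0 ψ I]
    constructor
    · exact fun h => eq_one_of_isIdempotentElem_of_sub_one_mem ((he.idem I).map ψ) h
    · intro h; rw [h, sub_self]; exact (maximalIdeal ↥V).zero_mem
  have h1 : Nat.card {ψ : B →ₐ[↥V] ↥V // (residue ↥V).comp (ψ : B →+* ↥V) = (χ : B →+* ResidueField ↥V)} =
      Nat.card {ψ : B →ₐ[↥V] ↥V // ψ (e I) = 1} :=
    Nat.card_congr (Equiv.subtypeEquivRight hiff)
  -- the corner `B ⧸ (1 - e I)`: free, finite, with reduced generic fibre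
  haveI : Module.Free (↥V) (B ⧸ Ideal.span {1 - e I}) := Literature.RingTheory.Idempotents.free_quotient_span_one_sub (R := ↥V) (he.idem I)
  haveI : IsReduced (Ω ⊗[↥V] (B ⧸ Ideal.span {1 - e I})) :=
    Literature.RingTheory.Idempotents.isReduced_tensorProduct_quotient_span_one_sub (R := ↥V) (Ω := Ω) (he.idem I)
  haveI : Finite ((B ⧸ Ideal.span {1 - e I}) →ₐ[↥V] Ω) :=
    Literature.RingTheory.Etale.finite_algHom_of_free (↥V) (B ⧸ Ideal.span {1 - e I}) Ω
  rw [h1, V.card_algHom_apply_eq_one_eq (C := B) (e I),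
    Literature.RingTheory.Idempotents.card_algHom_map_eq_one_eq (R := ↥V) (Ω := Ω) (e := e) I,
    Literature.RingTheory.Etale.card_algHom_eq_finrank_of_isReduced_baseChange (↥V) (B ⧸ Ideal.span {1 - e I}) Ω]

/-- **… = the multiplicity of the point in the special fibre**: the same count equals the LENGTH of the special fibre `B_I ⧸ 𝔪B_I` of the local
corner `B_I = B ⧸ (1 - e I)` (★ `length_quotient_eq_finrank_of_isAlgClosed'`; the residue field of `V` is algebraically closed).
[cite: StacksProject, Tag 02M0] [cite: Liu2002, §10.1.3] -/
theorem card_algHom_residue_comp_eq_length [IsReduced (Ω ⊗[↥V] B)] [Fintype (MaximalSpectrum (B ⧸ (maximalIdeal ↥V).map (algebraMap (↥V) B)))]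
    (e : MaximalSpectrum (B ⧸ (maximalIdeal ↥V).map (algebraMap (↥V) B)) → B) (he : CompleteOrthogonalIdempotents e)
    (hsep1 : ∀ I, 1 - e I ∈ I.asIdeal.comap (Ideal.Quotient.mk _)) (hsep0 : ∀ I I', I ≠ I' → e I ∈ I'.asIdeal.comap (Ideal.Quotient.mk _))
    (hloc : ∀ I, IsLocalRing (B ⧸ Ideal.span {1 - e I}))
    (I : MaximalSpectrum (B ⧸ (maximalIdeal ↥V).map (algebraMap (↥V) B))) (χ : B →ₐ[↥V] ResidueField ↥V)
    (hχ : RingHom.ker (χ : B →+* ResidueField ↥V) = I.asIdeal.comap (Ideal.Quotient.mk _)) :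
    (Nat.card {ψ : B →ₐ[↥V] ↥V // (residue ↥V).comp (ψ : B →+* ↥V) = (χ : B →+* ResidueField ↥V)} : ℕ∞) =
      Module.length (B ⧸ Ideal.span {1 - e I})
        ((B ⧸ Ideal.span {1 - e I}) ⧸ (maximalIdeal ↥V).map (algebraMap (↥V) (B ⧸ Ideal.span {1 - e I}))) := by
  haveI := hloc I
  haveI : IsAlgClosed (ResidueField ↥V) := Literature.AlgebraicGeometry.Resolution.isAlgClosed_residueField_of_isAlgClosed V
  haveI : Module.Free (↥V) (B ⧸ Ideal.span {1 - e I}) := Literature.RingTheory.Idempotents.free_quotient_span_one_sub (R := ↥V) (he.idem I)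
  rw [V.card_algHom_residue_comp_eq e he hsep1 hsep0 I χ hχ,
    Literature.RingTheory.Idempotents.length_quotient_eq_finrank_of_isAlgClosed' (R := ↥V) (C := B ⧸ Ideal.span {1 - e I})]

/-- **The total count `#(B →ₐ[V] V) = finrank_V B`** (all `Ω`-points are integral; ★ p799165). [cite: StacksProject, Tag 00U3] [cite: Liu2002, §10.1.3] -/
theorem card_algHom_eq_finrank [IsReduced (Ω ⊗[↥V] B)] : Nat.card (B →ₐ[↥V] ↥V) = Module.finrank (↥V) B := by
  haveI : Algebra.IsIntegral (↥V) B := Algebra.IsIntegral.of_finite (↥V) B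
  rw [V.card_algHom_eq_card_algHom_field (C := B), Literature.RingTheory.Etale.card_algHom_eq_finrank_of_isReduced_baseChange (↥V) B Ω]

omit [IsAlgClosed Ω] in
/-- … and `finrank_V B = Σ_I finrank_V (B ⧸ (1 - e I))` over the corners (★ p799283). [cite: StacksProject, Tag 04GG] -/
theorem sum_finrank_corner_eq [Fintype (MaximalSpectrum (B ⧸ (maximalIdeal ↥V).map (algebraMap (↥V) B)))]
    (e : MaximalSpectrum (B ⧸ (maximalIdeal ↥V).map (algebraMap (↥V) B)) → B) (he : CompleteOrthogonalIdempotents e) :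
    ∑ I, Module.finrank (↥V) (B ⧸ Ideal.span {1 - e I}) = Module.finrank (↥V) B :=
  (Literature.RingTheory.Idempotents.finrank_eq_sum_finrank_quotient (R := ↥V) he).symm

/-! ### Ring-map currency (appended 2026-08-31 for the geometric assembly `Motives/FiniteFlatCoverReductionMultiset`): the corner of a RING map
`χ : B → κ(V)` under `V` — the shape in which a `κ(R)`-point of the special fibre of a finite cover arrives (`(pullback.lift …).appTop ≫ ΓSpecIso`) —
and the counts above restated for it. -/

omit [Module.Free V B] in
/-- **The corner of a `κ(V)`-point.**  For `B` module-finite over the valuation ring `V` of an algebraically closed field and a RING map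
`χ : B → κ(V)` under `V` (`χ ∘ algebraMap = residue`): `B ⧸ 𝔪B` has finitely many maximal ideals, `B` carries a separating complete orthogonal
family of idempotents `e` indexed by them with LOCAL corners `B ⧸ (1 - e_I)` (★ `exists_completeOrthogonalIdempotents_isLocalRing`), and `ker χ`
(a maximal ideal: `χ` is onto `κ(V)`) is the contraction of one of them, `I_χ`. [cite: StacksProject, Tag 04GG] -/
theorem exists_corner_of_ringHom (χ : B →+* ResidueField V) (hχ : χ.comp (algebraMap V B) = residue V) :
    ∃ (_ : Fintype (MaximalSpectrum (B ⧸ (maximalIdeal V).map (algebraMap V B))))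
      (e : MaximalSpectrum (B ⧸ (maximalIdeal V).map (algebraMap V B)) → B) (I : MaximalSpectrum (B ⧸ (maximalIdeal V).map (algebraMap V B))),
      CompleteOrthogonalIdempotents e ∧ (∀ I, 1 - e I ∈ I.asIdeal.comap (Ideal.Quotient.mk _)) ∧
      (∀ I I', I ≠ I' → e I ∈ I'.asIdeal.comap (Ideal.Quotient.mk _)) ∧ (∀ I, IsLocalRing (B ⧸ Ideal.span {1 - e I})) ∧
      RingHom.ker χ = I.asIdeal.comap (Ideal.Quotient.mk _) := by
  haveI := Literature.RingTheory.Idempotents.isArtinianRing_quotient (R := V) (A := B)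
  letI : Fintype (MaximalSpectrum (B ⧸ (maximalIdeal V).map (algebraMap V B))) := Fintype.ofFinite _
  obtain ⟨e, he, hsep1, hsep0, hloc⟩ := V.exists_completeOrthogonalIdempotents_isLocalRing (A := B)
  -- `χ` is onto the residue field, so its kernel is a maximal ideal of `B`
  have hsurj : Function.Surjective χ := fun t => by
    obtain ⟨r, rfl⟩ := IsLocalRing.residue_surjective t
    exact ⟨algebraMap V B r, by rw [← RingHom.comp_apply, hχ]⟩
  have hmax := RingHom.ker_isMaximal_of_surjective χ hsurj
  exact ⟨inferInstance, e, ⟨_, Literature.RingTheory.Idempotents.isMaximal_map_mk (R := V) _ hmax⟩, he, hsep1, hsep0, hloc,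
    (Literature.RingTheory.Idempotents.comap_map_mk (R := V) _ hmax).symm⟩


/-- ★ `card_algHom_residue_comp_eq` for a RING map `χ : B → κ(V)` under `V`: the integral points `g : B →ₐ[V] V` with residue `χ` number
`rank_V (B ⧸ (1 - e_{I_χ}))`. [cite: StacksProject, Tag 04GG] [cite: Liu2002, §10.1.3] -/
theorem card_algHom_residue_comp_eq_of_ringHom [IsReduced (Ω ⊗[↥V] B)]
    [Fintype (MaximalSpectrum (B ⧸ (maximalIdeal V).map (algebraMap V B)))]
    (e : MaximalSpectrum (B ⧸ (maximalIdeal V).map (algebraMap V B)) → B) (he : CompleteOrthogonalIdempotents e)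
    (hsep1 : ∀ I, 1 - e I ∈ I.asIdeal.comap (Ideal.Quotient.mk _)) (hsep0 : ∀ I I', I ≠ I' → e I ∈ I'.asIdeal.comap (Ideal.Quotient.mk _))
    (I : MaximalSpectrum (B ⧸ (maximalIdeal V).map (algebraMap V B)))
    (χ : B →+* ResidueField V) (hχ : χ.comp (algebraMap V B) = residue V) (hI : RingHom.ker χ = I.asIdeal.comap (Ideal.Quotient.mk _)) :
    Nat.card {g : B →ₐ[↥V] ↥V // (residue ↥V).comp (g : B →+* ↥V) = χ} = Module.finrank (↥V) (B ⧸ Ideal.span {1 - e I}) :=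
  card_algHom_residue_comp_eq V e he hsep1 hsep0 I (AlgHom.mk χ fun r => RingHom.congr_fun hχ r) hI

/-- … `= length (B_I ⧸ 𝔪 B_I)`, the multiplicity of the point `I` in the special fibre `B ⧸ 𝔪B` (★ `card_algHom_residue_comp_eq_length`).
[cite: StacksProject, Tag 02M0] [cite: Liu2002, §10.1.3] -/
theorem card_algHom_residue_comp_eq_length_of_ringHom [IsReduced (Ω ⊗[↥V] B)]
    [Fintype (MaximalSpectrum (B ⧸ (maximalIdeal V).map (algebraMap V B)))]
    (e : MaximalSpectrum (B ⧸ (maximalIdeal V).map (algebraMap V B)) → B) (he : CompleteOrthogonalIdempotents e)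
    (hsep1 : ∀ I, 1 - e I ∈ I.asIdeal.comap (Ideal.Quotient.mk _)) (hsep0 : ∀ I I', I ≠ I' → e I ∈ I'.asIdeal.comap (Ideal.Quotient.mk _))
    (hloc : ∀ I, IsLocalRing (B ⧸ Ideal.span {1 - e I}))
    (I : MaximalSpectrum (B ⧸ (maximalIdeal V).map (algebraMap V B)))
    (χ : B →+* ResidueField V) (hχ : χ.comp (algebraMap V B) = residue V) (hI : RingHom.ker χ = I.asIdeal.comap (Ideal.Quotient.mk _)) :
    (Nat.card {g : B →ₐ[↥V] ↥V // (residue ↥V).comp (g : B →+* ↥V) = χ} : ℕ∞) =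
      Module.length (B ⧸ Ideal.span {1 - e I}) ((B ⧸ Ideal.span {1 - e I}) ⧸ (maximalIdeal ↥V).map (algebraMap (↥V) (B ⧸ Ideal.span {1 - e I}))) :=
  card_algHom_residue_comp_eq_length V e he hsep1 hsep0 hloc I (AlgHom.mk χ fun r => RingHom.congr_fun hχ r) hI

end ValuationSubring
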